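import Mathlib
import Literature.MathematicalPhysics.QuantumFieldTheory.Balaban1983to89.B5Hk165PolarZd

/-!
# Bałaban [B5] p.29, scalar, whole lattice `ℤ^d`: `H_k` and `Δ_k` COMMUTE WITH UNIT-LATTICE TRANSLATIONS —
# `H(p + (n+1)z, y + z) = H(p, y)`, `(Q'G'Q'*)⁻¹(y₁ + z, y₂ + z) = (Q'G'Q'*)⁻¹(y₁, y₂)`: the scalar `Δ_k` is a
# convolution kernel (the structural prerequisite of the momentum representation (1.66))

**Source (verbatim; the quotation LOCATES the statement — nothing printed is used as a hypothesis).**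
[B5] = T. Bałaban, *Propagators and renormalization transformations for lattice gauge theories. I*, Commun. Math.
Phys. **95** (1984) 17–40 [`Balaban1984PropagatorsI`], p. 29 [PDF 13]: «The action Δ_k is thus defined by
⟨B, Δ_kB⟩ = ⟨∂H_kB, ∂H_kB⟩. (1.65) Using formulas (1.60) or (1.63) we obtain the following expression
⟨B, Δ_kB⟩ = ½ Σ_{μ,ν} ⟨(∂¹_μB_ν − ∂¹_νB_μ), […] (∂¹_μB_ν − ∂¹_νB_μ)⟩ = ⟨∂₁B, σ_k∂₁B⟩ = ½ Σ_{μ,ν} (2π)^{−d} ∫dp′ […]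
|(∂₁B)~_{μν}(p′)|². (1.66) The function under the integral is bounded from below and above by positive constants
γ₀, γ₁ dependent on d only […]» (the bracketed ellipses elide the printed multiplier; it is not used here).  A
momentum-space representation of `⟨B, Δ_kB⟩` presupposes that `Δ_k` commutes with the translations of the unit
lattice; this file proves that prerequisite, kernel-explicitly, for the scalar whole-lattice objects of this
seat's nodes 5–10.  The formula (1.66) itself is NOT derived.

**What is proved here (zero `sorry`; every `d`, every block side `n + 1 ≥ 1`, every `a > 0`).**  Objects: sites
`X d = ℤ^d`, blocks `B n y` (side `n + 1`, unit-lattice label `y`), the scalar `H = kerH` and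
`(Q'G'Q'*)⁻¹ = Kinv` (node 5), the weak Euler–Lagrange class `WeakEL` and the uniqueness theorem `col_eq_kerH`
(node 6), the Dirichlet pairing `energy₂` and the Gram reading `energy₂_kerH_col_eq` of the action kernel
`actionKer = Kinv − a·δ` (nodes 8, 10).  `bshift n z = (n+1)·z` is the site translation induced by the
unit-lattice translation `z`.
* §1 [folklore] `chart_add` / `sum_B_add` (the block of `y + z` is the block of `y` shifted by `(n+1)z`),
  `lapDir_add_right` / `lapKer_add_right` (the Laplacian kernel is translation invariant).
* §2 **`weakEL_translate`** — the weak Euler–Lagrange class is invariant under block-lattice shifts (shift the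
  test function back).
* §3 **`kerH_translate` — `H(p + (n+1)z, y + z) = H(p, y)`** (node 6's uniqueness `col_eq_kerH`: the shifted column
  is square-summable, has the right block sums, and is a weak solution); `kerH_eq_col_zero`:
  `H(p, y) = H(p − (n+1)y, 0)`.
* §4 `energy₂_translate` and **`actionKer_translate` / `Kinv_translate` — `(Q'G'Q'*)⁻¹(y₁ + z, y₂ + z) =
  (Q'G'Q'*)⁻¹(y₁, y₂)`** (node 10's Gram reading `Δ^{scalar}(y₁,y₂) = (n+1)^{2−d}⟨∇H(·,y₁), ∇H(·,y₂)⟩` and §3);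
  `Kinv_eq_col_zero`: `(Q'G'Q'*)⁻¹(y₁, y₂) = (Q'G'Q'*)⁻¹(y₁ − y₂, 0)` — the scalar `Δ_k` IS a convolution kernel.

RELATION TO THE TREE (by name; nothing is imported from `Beta/`): on finite tori the β cell's typed operators are
translation-covariant by construction of the torus; on `ℤ^d` the inverse `Kinv` is an infinite-volume LIMIT of
finite-volume inverses over growing boxes (node 2, `B4Sect5Exhaustion.limInv`), which are NOT translation
invariant — the invariance is recovered here from UNIQUENESS (node 6), not from the construction.

HONEST SCOPE.  (i) SCALAR analogue (plain block means, no gauge condition); (ii) WHOLE lattice `ℤ^d`;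
(iii) (1.66) (the explicit multiplier) and the right half of (1.67) are NOT derived — only the translation
covariance they presuppose; (iv) NOT summit progress — kernel discharge of the scalar infinite-volume column.

ABSOLUTE-RULE CENSUS: every theorem below is proved outright from the tree modules named above and Mathlib
(sorry-free; axioms `propext`, `Classical.choice`, `Quot.sound` only); no quoted statement is used as a hypothesis;
the only hypothesis of the headline theorems is `0 < a`.  Unit `b2b-balaban-pv23-g7` (surge node prover #23,
gen 7; journal claim B5-166-TRANSL-SCALAR-ZD).
-/

namespace Literature.MathematicalPhysics.QuantumFieldTheory.Balaban1983to89.B5Hk165TranslZd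

open Finset Real Filter Topology
open B6QGQLower276 B6QGQDecay237 B5Hk103ScalarZd B5Hk103Unique B5Hk103Minimizer B5Hk165ActionZd
  B5Hk165PolarZd

noncomputable section

variable {d : ℕ}

/-! ## §1  Block-lattice translations [folklore] -/

/-- The site translation induced by the unit-lattice translation `z`: `bshift n z = (n+1)·z`. [folklore] -/
def bshift (n : ℕ) (z : X d) : X d := ((n + 1 : ℕ) : ℤ) • z

/-- The chart of the block `y + z` is the chart of `y` shifted by `(n+1)z`. [folklore] -/
theorem chart_add (n : ℕ) (y z : X d) (w : Fin d → Fin (n + 1)) :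
    chart n (y + z) w = chart n y w + bshift n z := by
  funext ν
  simp only [chart, side, bshift, Pi.add_apply, Pi.smul_apply, smul_eq_mul]
  push_cast
  ring

/-- A sum over the block of `y + z` is the sum over the block of `y` of the summand shifted by `(n+1)z`.
[folklore] -/
theorem sum_B_add (n : ℕ) (y z : X d) (f : X d → ℝ) :
    ∑ p ∈ B n (y + z), f p = ∑ p ∈ B n y, f (p + bshift n z) := by
  rw [sum_B, sum_B]
  exact Finset.sum_congr rfl fun w _ => by rw [chart_add]

/-- The directional second-difference kernel is translation invariant. [folklore] -/
theorem lapDir_add_right (μ : Fin d) (p q v : X d) : lapDir μ (p + v) (q + v) = lapDir μ p q := by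
  simp only [lapDir, add_right_comm p v (e μ), add_sub_right_comm p v (e μ), add_left_inj]

/-- The Laplacian kernel is translation invariant: `(−Δ)(p + v, q + v) = (−Δ)(p, q)`. [folklore] -/
theorem lapKer_add_right (p q v : X d) : lapKer (p + v) (q + v) = lapKer p q :=
  Finset.sum_congr rfl fun μ _ => lapDir_add_right μ p q v

/-! ## §2  The weak Euler–Lagrange class is invariant under block-lattice shifts [folklore] -/

/-- **If `D` is a weak solution (`WeakEL n D`), so is `p ↦ D(p + (n+1)z)`** — test it against the back-shifted
test field `A'(· − (n+1)z)`, which is again finitely supported with zero block means. [folklore] -/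
theorem weakEL_translate {n : ℕ} {D : X d → ℝ} (hD : WeakEL n D) (z : X d) :
    WeakEL n fun p => D (p + bshift n z) := by
  classical
  intro S A' hS hQ
  show ∑' p, (∑ r ∈ S, ((n : ℝ) + 1) ^ 2 * lapKer p r * A' r) * D (p + bshift n z) = 0
  -- the back-shifted test field
  have hS'' : ∀ r ∉ S.image (· + bshift n z), A' (r - bshift n z) = 0 := by
    intro r hr
    apply hS
    intro h'
    exact hr (Finset.mem_image.2 ⟨r - bshift n z, h', sub_add_cancel r (bshift n z)⟩)
  have hQ'' : ∀ y'' : X d, ∑ r ∈ B n y'', A' (r - bshift n z) = 0 := by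
    intro y''
    have h := sum_B_add n (y'' - z) z (fun r => A' (r - bshift n z))
    rw [sub_add_cancel] at h
    rw [h]
    simpa only [add_sub_cancel_right] using hQ (y'' - z)
  have h0 := hD (S.image (· + bshift n z)) (fun r => A' (r - bshift n z)) hS'' hQ''
  -- the test sum, re-indexed
  have key : ∀ p : X d, (∑ r ∈ S, ((n : ℝ) + 1) ^ 2 * lapKer p r * A' r) =
      ∑ r ∈ S.image (· + bshift n z),
        ((n : ℝ) + 1) ^ 2 * lapKer (p + bshift n z) r * A' (r - bshift n z) := by
    intro p
    rw [Finset.sum_image fun r _ r' _ h => add_left_injective (bshift n z) h]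
    refine Finset.sum_congr rfl fun r _ => ?_
    rw [lapKer_add_right, add_sub_cancel_right]
  calc ∑' p, (∑ r ∈ S, ((n : ℝ) + 1) ^ 2 * lapKer p r * A' r) * D (p + bshift n z)
      = ∑' p, (∑ r ∈ S.image (· + bshift n z),
          ((n : ℝ) + 1) ^ 2 * lapKer (p + bshift n z) r * A' (r - bshift n z)) * D (p + bshift n z) :=
        tsum_congr fun p => by rw [key p]
    _ = ∑' q, (∑ r ∈ S.image (· + bshift n z),
          ((n : ℝ) + 1) ^ 2 * lapKer q r * A' (r - bshift n z)) * D q :=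
        tsum_addRight (F := fun q => (∑ r ∈ S.image (· + bshift n z),
          ((n : ℝ) + 1) ^ 2 * lapKer q r * A' (r - bshift n z)) * D q) (bshift n z)
    _ = 0 := h0

/-! ## §3  `H` commutes with translations [print-located; proved outright] -/

/-- **`H(p + (n+1)z, y + z) = H(p, y)`** — the scalar `H = G'Q'*(Q'G'Q'*)⁻¹` on `ℤ^d` commutes with the
translations of the unit lattice (uniqueness, node 6: the shifted column is square-summable, has block sums
`(n+1)^d δ_{y'' y}`, and is a weak solution by §2). [cite: Balaban1984PropagatorsI, (1.66) p.29] -/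
theorem kerH_translate (n : ℕ) {a : ℝ} (ha : 0 < a) (p y z : X d) :
    kerH n a (p + bshift n z) (y + z) = kerH n a p y := by
  classical
  refine col_eq_kerH n ha y (fun q => kerH n a (q + bshift n z) (y + z))
    (summable_sq_shift (summable_kerH_sq n ha (y + z)) (bshift n z)) (fun y'' => ?_)
    (weakEL_translate (weakEL_kerH_col n ha (y + z)) z) p
  show ∑ q ∈ B n y'', kerH n a (q + bshift n z) (y + z) = ((n : ℝ) + 1) ^ d * (if y'' = y then 1 else 0)
  rw [← sum_B_add n y'' z (fun q => kerH n a q (y + z)), sum_B_kerH n ha (y'' + z) (y + z)]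
  simp only [add_left_inj]

/-- `H(p, y) = H(p − (n+1)y, 0)`: the kernel of `H` depends on `(p, y)` only through `p − (n+1)y`. [folklore] -/
theorem kerH_eq_col_zero (n : ℕ) {a : ℝ} (ha : 0 < a) (p y : X d) :
    kerH n a p y = kerH n a (p - bshift n y) 0 := by
  have h := kerH_translate n ha (p - bshift n y) 0 y
  rw [zero_add, sub_add_cancel] at h
  exact h

/-! ## §4  `(Q'G'Q'*)⁻¹` and `Δ_k^{scalar}` are convolution kernels [print-located; proved outright] -/

/-- The Dirichlet pairing is invariant under a common site translation. [folklore] -/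
theorem energy₂_translate (A A' : X d → ℝ) (v : X d) :
    energy₂ (fun p => A (p + v)) (fun p => A' (p + v)) = energy₂ A A' := by
  unfold energy₂
  refine Finset.sum_congr rfl fun μ _ => ?_
  simp only [add_right_comm _ (e μ) v]
  exact tsum_addRight (F := fun p => (A p - A (p + e μ)) * (A' p - A' (p + e μ))) v

/-- **`Δ^{scalar}(y₁ + z, y₂ + z) = Δ^{scalar}(y₁, y₂)`**: the scalar action kernel is a convolution kernel on
`ℤ^d` (Gram reading of node 10 + `kerH_translate`). [cite: Balaban1984PropagatorsI, (1.66) p.29] -/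
theorem actionKer_translate (n : ℕ) {a : ℝ} (ha : 0 < a) (y₁ y₂ z : X d) :
    actionKer n a (y₁ + z) (y₂ + z) = actionKer n a y₁ y₂ := by
  have h := energy₂_kerH_col_eq n ha (y₁ + z) (y₂ + z)
  have h0 := energy₂_kerH_col_eq n ha y₁ y₂
  have hcol : ∀ y : X d, (fun p => kerH n a p (y + z)) = fun p => kerH n a (p + -bshift n z) y := by
    intro y
    funext p
    have h1 := kerH_translate n ha (p + -bshift n z) y z
    rwa [neg_add_cancel_right] at h1
  rw [hcol y₁, hcol y₂,
    energy₂_translate (fun p => kerH n a p y₁) (fun p => kerH n a p y₂) (-bshift n z)] at h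
  have hc : (0 : ℝ) < ((n : ℝ) + 1) ^ d := by positivity
  exact mul_left_cancel₀ hc.ne' (h.symm.trans h0)

/-- **`(Q'G'Q'*)⁻¹(y₁ + z, y₂ + z) = (Q'G'Q'*)⁻¹(y₁, y₂)`** on `ℤ^d`. [cite: Balaban1984PropagatorsI, (1.66) p.29] -/
theorem Kinv_translate (n : ℕ) {a : ℝ} (ha : 0 < a) (y₁ y₂ z : X d) :
    Kinv n a (y₁ + z) (y₂ + z) = Kinv n a y₁ y₂ := by
  have h := actionKer_translate n ha y₁ y₂ z
  unfold actionKer at h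
  simp only [add_left_inj] at h
  linarith

/-- `(Q'G'Q'*)⁻¹(y₁, y₂) = (Q'G'Q'*)⁻¹(y₁ − y₂, 0)`: the inverse depends only on the difference. [folklore] -/
theorem Kinv_eq_col_zero (n : ℕ) {a : ℝ} (ha : 0 < a) (y₁ y₂ : X d) :
    Kinv n a y₁ y₂ = Kinv n a (y₁ - y₂) 0 := by
  have h := Kinv_translate n ha (y₁ - y₂) 0 y₂
  rw [zero_add, sub_add_cancel] at h
  exact h

/-- The coarse action form is translation invariant: shifting the field and its support box together does not
change `Σ B(y'')B(y)Δ^{scalar}(y'',y)`. [folklore] -/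
theorem actionForm_translate (n : ℕ) {a : ℝ} (ha : 0 < a) (T : Finset (X d)) (Bf : X d → ℝ) (z : X d) :
    actionForm n a (T.image (· + z)) (fun y => Bf (y - z)) = actionForm n a T Bf := by
  classical
  unfold actionForm
  rw [Finset.sum_image fun y _ y' _ h => add_left_injective z h]
  refine Finset.sum_congr rfl fun y'' _ => ?_
  rw [Finset.sum_image fun y _ y' _ h => add_left_injective z h]
  refine Finset.sum_congr rfl fun y _ => ?_
  simp only [add_sub_cancel_right, actionKer_translate n ha]

end

end Literature.MathematicalPhysics.QuantumFieldTheory.Balaban1983to89.B5Hk165TranslZd
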